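import Mathlib.Analysis.Calculus.MeanValue
import Mathlib.Topology.MetricSpace.Basic

/-!
# Mean-value reduction to the leg form: uniform closeness from a vanishing derivative bound

Helper file for the crux `QuadrupoleSelectionRule` (stmt-CriticalPhenomena-7029), route
`CardyFlipRusso`, sub-problem `CardyFormulaZ2`, line `Sketch` generation 2 ("TransferR2"),
stub T6 "mean-value reduction to the leg form".

Let `P σ δ` be a family of (crossing) probabilities along a leg `σ ∈ [0, σ₀]` at mesh `δ`, with a
derivative `D σ δ` in `σ` within `[0, σ₀]` (the annealed Russo derivative along the leg) for every
mesh `0 < δ < 1`.  If `|D σ δ| ≤ η δ` uniformly in `σ ∈ [0, σ₀]` and `η δ → 0` as `δ → 0⁺`, then the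
probabilities are uniformly close along the leg for small mesh: for every `ε > 0` there is
`δ₀ > 0` such that `|P σ δ − P σ' δ| ≤ ε` for all `0 < δ < δ₀` and all `σ, σ' ∈ [0, σ₀]`.

This is exactly the shape of the typing draft `QuadrupoleSelectionRuleLegDraft` in
`Cruxes/QuadrupoleSelectionRule/Lines/SketchTypingDraft.lean`, obtained from the derivative bound by
the mean value inequality on the convex set `[0, σ₀]`
(`Convex.norm_image_sub_le_of_norm_hasDerivWithin_le`): `|P σ δ − P σ' δ| ≤ η δ · |σ − σ'| ≤ η δ · σ₀`,
and `η δ < ε / σ₀` for `δ` small.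

All statements are elementary real analysis (Mathlib's mean value inequality and the metric
`ε`–`δ` characterisation of `Tendsto` at `𝓝[>] 0`).
-/

noncomputable section

open Filter Topology Set

namespace Summit.CriticalPhenomena.CardyFormulaZ2.Theorems

/-- Mean value inequality along the leg `[0, σ₀]`: if `σ ↦ P σ` has derivative `D σ` within
`[0, σ₀]` at every point of `[0, σ₀]` and `|D σ| ≤ C` there, then
`|P σ − P σ'| ≤ C · σ₀` for all `σ, σ' ∈ [0, σ₀]`. [folklore] -/
theorem abs_sub_le_mul_of_hasDerivWithinAt_Icc (P D : ℝ → ℝ) (σ₀ C : ℝ)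
    (hderiv : ∀ σ ∈ Icc (0 : ℝ) σ₀, HasDerivWithinAt P (D σ) (Icc (0 : ℝ) σ₀) σ)
    (hbound : ∀ σ ∈ Icc (0 : ℝ) σ₀, |D σ| ≤ C) (σ : ℝ) (hσ : σ ∈ Icc (0 : ℝ) σ₀) (σ' : ℝ)
    (hσ' : σ' ∈ Icc (0 : ℝ) σ₀) : |P σ - P σ'| ≤ C * σ₀ := by
  -- the mean value inequality on the convex set `[0, σ₀]`
  have hmvt : ‖P σ - P σ'‖ ≤ C * ‖σ - σ'‖ :=
    (convex_Icc (0 : ℝ) σ₀).norm_image_sub_le_of_norm_hasDerivWithin_le hderiv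
      (fun x hx => (Real.norm_eq_abs _).trans_le (hbound x hx)) hσ' hσ
  rw [Real.norm_eq_abs, Real.norm_eq_abs] at hmvt
  -- `C ≥ 0` since it bounds an absolute value (at `σ ∈ [0, σ₀]`), and `|σ − σ'| ≤ σ₀`
  have hC : 0 ≤ C := le_trans (abs_nonneg _) (hbound σ hσ)
  have hdiff : |σ - σ'| ≤ σ₀ := by
    rw [abs_sub_le_iff]
    constructor <;> linarith [hσ.1, hσ.2, hσ'.1, hσ'.2]
  exact hmvt.trans (mul_le_mul_of_nonneg_left hdiff hC)

/-- **Mean-value reduction to the leg form** (stub T6 of line `Sketch`, generation 2, for the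
crux `QuadrupoleSelectionRule`).  A `σ`-uniform bound `|D σ δ| ≤ η δ` with `η δ → 0` as `δ → 0⁺`
on the derivative `D` of `σ ↦ P σ δ` within the leg `[0, σ₀]` (for meshes `0 < δ < 1`) gives
uniform closeness of `P · δ` along the leg for small mesh: for every `ε > 0` there is `δ₀ > 0`
with `|P σ δ − P σ' δ| ≤ ε` for all `0 < δ < δ₀` and `σ, σ' ∈ [0, σ₀]`. [folklore] -/
theorem uniform_close_of_deriv_bound (P D : ℝ → ℝ → ℝ) (η : ℝ → ℝ) (σ₀ : ℝ) (hσ₀ : 0 < σ₀)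
    (hderiv : ∀ δ, 0 < δ → δ < 1 → ∀ σ ∈ Icc (0 : ℝ) σ₀,
      HasDerivWithinAt (fun s => P s δ) (D σ δ) (Icc (0 : ℝ) σ₀) σ)
    (hbound : ∀ δ, 0 < δ → δ < 1 → ∀ σ ∈ Icc (0 : ℝ) σ₀, |D σ δ| ≤ η δ)
    (hη : Tendsto η (𝓝[>] 0) (𝓝 0)) :
    ∀ ε : ℝ, 0 < ε → ∃ δ₀ : ℝ, 0 < δ₀ ∧ ∀ δ : ℝ, 0 < δ → δ < δ₀ →
      ∀ σ ∈ Icc (0 : ℝ) σ₀, ∀ σ' ∈ Icc (0 : ℝ) σ₀, |P σ δ - P σ' δ| ≤ ε := by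
  intro ε hε
  -- `η δ → 0` as `δ → 0⁺`: pick `d > 0` with `|η δ| < ε / σ₀` for `0 < δ < d`
  rw [Metric.tendsto_nhdsWithin_nhds] at hη
  obtain ⟨d, hd, hηd⟩ := hη (ε / σ₀) (div_pos hε hσ₀)
  refine ⟨min d 1, lt_min hd one_pos, fun δ hδ hδlt σ hσ σ' hσ' => ?_⟩
  have hδd : δ < d := lt_of_lt_of_le hδlt (min_le_left _ _)
  have hδ1 : δ < 1 := lt_of_lt_of_le hδlt (min_le_right _ _)
  have hηδ : |η δ| < ε / σ₀ := by
    have h := hηd (show δ ∈ Ioi (0 : ℝ) from hδ) (by rwa [Real.dist_0_eq_abs, abs_of_pos hδ])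
    rwa [Real.dist_0_eq_abs] at h
  -- mean value inequality along the leg at mesh `δ`, then `η δ · σ₀ ≤ (ε / σ₀) · σ₀ = ε`
  have hmvt : |P σ δ - P σ' δ| ≤ η δ * σ₀ :=
    abs_sub_le_mul_of_hasDerivWithinAt_Icc (fun s => P s δ) (fun s => D s δ) σ₀ (η δ)
      (hderiv δ hδ hδ1) (hbound δ hδ hδ1) σ hσ σ' hσ'
  calc |P σ δ - P σ' δ| ≤ η δ * σ₀ := hmvt
    _ ≤ ε / σ₀ * σ₀ := mul_le_mul_of_nonneg_right ((le_abs_self _).trans hηδ.le) hσ₀.le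
    _ = ε := div_mul_cancel₀ ε hσ₀.ne'

end Summit.CriticalPhenomena.CardyFormulaZ2.Theorems

end
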